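import Summits.ABC.ABC.Theorems.TowerFourSubLiouville.Negative.LogLoss

/-!
# `TowerFourSubLiouville` (stmt-ABC-1649): at `A = 1` even the loss `log c / (log log c)^B`, `B > 1`, fails

Negative-side calibration (standing disprover, cycle 6, refuter-cdisprove-stmt-ABC-1649-g6-0), sharpening
`Negative.LogLoss.not_towerIneq4One_logLoss` (cycle 2: no `c ≤ C · Π · (log c)^A` for `A < 1`) to the exact
reach of the Pell–Matiyasevich witness family: there is NO pair `(C, c₀)` with
`c · (log log c)^B ≤ C · Π · log c` for all positive coprime level-4 tower points with `c ≥ c₀`, for any real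
`B > 1` (`not_towerIneq4One_logLossLogLog`; the threshold `c₀` makes the refuted statement weaker, i.e. the
refutation stronger, and removes any dependence on small points).

The family (`pell_family_two_pow`, = `Negative.LogLoss.pell_family` with the lower bound `2^m ≤ x_m`,
`Pell.xn_ge_a_pow`, added): `w = y_{N+1} ≥ 3^N`, `m = (N+1)w`, `y_m = w²t`, `u = x_m ∈ [2^m, 4^m]`; the point
`x = (1,1,1,1)`, `y = (3,t,1,w)`, `z = (1,u,1,1)` has `c = u²`, `Π = 3tuw`, gain `c/Π = u/(3tw) ≥ w/3`, and
`w ≤ log c ≤ 3(N+1)w` with `N ≤ log₃ w ≤ log log c`: so the gain is `≍ log c / log log c` EXACTLY along the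
family.  Consequently the supposed bound gives `(log log c)^B ≤ 9C(N+1) ≤ 18 C N` while `log log c ≥ N log 3`,
i.e. `N^{B−1} ≲ 18C` — impossible for large `N` when `B > 1` (`key_growth` with exponent `1/B`).  The case
`B ≤ 1` (in particular the bare loss `log c`, and `log c / log log c`) is out of reach of every Pell/Lucas-type
family (the square part of `y_m` is `≲ m`), and is left open; the probabilistic expectation is a polylogarithmic
loss at `A = 1`.
-/

-- `Summit.ABC.ABC` is the mandated summit-side namespace (CONVENTIONS §2); the duplicate is deliberate.
set_option linter.dupNamespace false

namespace Summit.ABC.ABC.Theorems.TowerFourSubLiouville.Negative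

open scoped BigOperators
open Summit.ABC.ABC.Theses.IneffectiveSubspace

/-- The Pell–Matiyasevich family with the exponential LOWER bound on `u` recorded: for every `N` there are
`t, w ≥ 1` and `u` with `3^N ≤ w`, `w²t ≤ u`, `2^{(N+1)w} ≤ u ≤ 4^{(N+1)w}` and `1 + 3(w²t)² = u²`. -/
theorem pell_family_two_pow (N : ℕ) : ∃ t u w : ℕ, 0 < t ∧ 0 < w ∧ 3 ^ N ≤ w ∧ w * w * t ≤ u ∧
    2 ^ ((N + 1) * w) ≤ u ∧ u ≤ 4 ^ ((N + 1) * w) ∧ 1 + 3 * (w * w * t) ^ 2 = u ^ 2 := by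
  obtain ⟨w, hw⟩ : ∃ w, Pell.yn one_lt_two' (N + 1) = w := ⟨_, rfl⟩
  have hw3 : 3 ^ N ≤ w := hw ▸ pell3_three_pow_le_y N
  have hw0 : 0 < w := lt_of_lt_of_le (pow_pos (by norm_num) N) hw3
  obtain ⟨u, hu⟩ : ∃ u, Pell.xn one_lt_two' ((N + 1) * w) = u := ⟨_, rfl⟩
  obtain ⟨v, hv⟩ : ∃ v, Pell.yn one_lt_two' ((N + 1) * w) = v := ⟨_, rfl⟩
  have hvu : v ≤ u := hu ▸ hv ▸ pell3_y_le_x _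
  have heq : 1 + 3 * v ^ 2 = u ^ 2 := by rw [← hu, ← hv, pell3]; ring
  have hdvd : w * w ∣ v := by
    have := Pell.ysq_dvd_yy one_lt_two' (N + 1)
    rwa [hw, hv] at this
  obtain ⟨t, ht⟩ := hdvd
  have hm0 : 0 < (N + 1) * w := Nat.mul_pos (Nat.succ_pos N) hw0
  have hv0 : 0 < v := hv ▸ lt_of_lt_of_le hm0 (Pell.yn_ge_n one_lt_two' _)
  have ht0 : 0 < t := by
    rcases Nat.eq_zero_or_pos t with h0 | h0
    · rw [h0, mul_zero] at ht; omega
    · exact h0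
  have hule : u ≤ 4 ^ ((N + 1) * w) := hu ▸ pell3_x_le_four_pow _
  have hlow : 2 ^ ((N + 1) * w) ≤ u := hu ▸ Pell.xn_ge_a_pow one_lt_two' _
  refine ⟨t, u, w, ht0, hw0, hw3, ht ▸ hvu, hlow, hule, ?_⟩
  rw [← ht]; exact heq

/-- The arithmetic extracted from the family under the supposed bound: for every `N ≥ 1` with `2^N ≥ c₀` there
is a real `ℓ` (`= log log c` of the `N`-th point) with `N · log 3 ≤ ℓ` and `ℓ^B ≤ 9C(N+1)`; and `C > 0`. -/
theorem logLossLogLog_key {C c₀ B : ℝ}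
    (h : ∀ x y z : Fin 4 → ℕ, (∀ i, 0 < x i ∧ 0 < y i ∧ 0 < z i) →
      (∏ i, x i ^ (i.val + 1)) + (∏ i, y i ^ (i.val + 1)) = ∏ i, z i ^ (i.val + 1) →
      Nat.Coprime (∏ i, x i ^ (i.val + 1)) (∏ i, y i ^ (i.val + 1)) →
      c₀ ≤ ((∏ i, z i ^ (i.val + 1) : ℕ) : ℝ) →
      ((∏ i, z i ^ (i.val + 1) : ℕ) : ℝ) * Real.log (Real.log (((∏ i, z i ^ (i.val + 1) : ℕ) : ℝ))) ^ B ≤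
        C * ((∏ i, x i * y i * z i : ℕ) : ℝ) * Real.log (((∏ i, z i ^ (i.val + 1) : ℕ) : ℝ)))
    (N : ℕ) (hN1 : 1 ≤ N) (hN : c₀ ≤ (2 : ℝ) ^ N) :
    ∃ ℓ : ℝ, (N : ℝ) * Real.log 3 ≤ ℓ ∧ 0 < C ∧ ℓ ^ B ≤ 9 * C * ((N : ℝ) + 1) := by
  obtain ⟨t, u, w, ht0, hw0, hw3, hwwt, hlow, hule, hfam⟩ := pell_family_two_pow N
  have hu0 : 0 < u := lt_of_lt_of_le (pow_pos (by norm_num) _) hlow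
  -- real-number versions
  have htR : (0 : ℝ) < t := by exact_mod_cast ht0
  have hwR : (0 : ℝ) < w := by exact_mod_cast hw0
  have huR : (0 : ℝ) < u := by exact_mod_cast hu0
  have hw3R : (3 : ℝ) ^ N ≤ w := by exact_mod_cast hw3
  have hwwtR : (w : ℝ) * w * t ≤ u := by exact_mod_cast hwwt
  have hlowR : (2 : ℝ) ^ ((N + 1) * w) ≤ u := by exact_mod_cast hlow
  have huleR : (u : ℝ) ≤ (4 : ℝ) ^ ((N + 1) * w) := by exact_mod_cast hule
  have hlog2 := Real.log_two_gt_d9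
  have hlog2' := Real.log_two_lt_d9
  have hlog3 : 1 < Real.log 3 := by
    rw [Real.lt_log_iff_exp_lt (by norm_num)]
    exact Real.exp_one_lt_three
  -- `L = 2 log u = log c`: `(N+1) w ≤ L ≤ 3 (N+1) w`
  set L : ℝ := 2 * Real.log u with hL
  have hNw0 : (0 : ℝ) < ((N : ℝ) + 1) * w := by positivity
  have hLlow : ((N : ℝ) + 1) * w ≤ L := by
    have h1 : Real.log ((2 : ℝ) ^ ((N + 1) * w)) ≤ Real.log u := Real.log_le_log (by positivity) hlowR
    rw [Real.log_pow] at h1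
    push_cast at h1
    rw [hL]; nlinarith
  have hLup : L ≤ 3 * (((N : ℝ) + 1) * w) := by
    have h1 : Real.log u ≤ Real.log ((4 : ℝ) ^ ((N + 1) * w)) := Real.log_le_log huR huleR
    rw [Real.log_pow] at h1
    push_cast at h1
    have hlog4 : Real.log 4 = 2 * Real.log 2 := by
      rw [show (4 : ℝ) = 2 ^ 2 by norm_num, Real.log_pow]; ring
    rw [hlog4] at h1
    rw [hL]; nlinarith
  have hN1R : (1 : ℝ) ≤ N := by exact_mod_cast hN1
  have hLw : (w : ℝ) ≤ L := le_trans (by nlinarith) hLlow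
  have hL0 : 0 < L := lt_of_lt_of_le hwR hLw
  -- `ℓ = log L ≥ N log 3 > 0`
  set ℓ : ℝ := Real.log L with hℓ
  have hℓlow : (N : ℝ) * Real.log 3 ≤ ℓ := by
    have h1 : Real.log ((3 : ℝ) ^ N) ≤ Real.log L := Real.log_le_log (by positivity) (le_trans hw3R hLw)
    rwa [Real.log_pow] at h1
  have hℓpos : 0 < ℓ := lt_of_lt_of_le (by nlinarith) hℓlow
  have hℓB : 0 < ℓ ^ B := Real.rpow_pos_of_pos hℓpos B
  -- the point of the family and the supposed bound there
  have hc₀ : c₀ ≤ (u : ℝ) ^ 2 := by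
    have h2N : (2 : ℝ) ^ N ≤ (2 : ℝ) ^ ((N + 1) * w) := by
      apply pow_le_pow_right₀ (by norm_num)
      calc N ≤ N + 1 := Nat.le_succ N
        _ = (N + 1) * 1 := by ring
        _ ≤ (N + 1) * w := Nat.mul_le_mul_left _ hw0
    have hu1 : (1 : ℝ) ≤ u := by exact_mod_cast hu0
    calc c₀ ≤ (2 : ℝ) ^ N := hN
      _ ≤ u := le_trans h2N hlowR
      _ ≤ (u : ℝ) ^ 2 := by nlinarith
  have hpt := h ![1, 1, 1, 1] ![3, t, 1, w] ![1, u, 1, 1]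
    (by intro i; fin_cases i <;> simp [ht0, hu0, hw0])
    (by simp [Fin.prod_univ_four]; nlinarith [hfam])
    (by simp [Fin.prod_univ_four])
    (by simp [Fin.prod_univ_four]; exact hc₀)
  simp [Fin.prod_univ_four] at hpt
  -- hpt : u² · ℓ^B ≤ C · (3 (t u) w) · L
  change (u : ℝ) ^ 2 * ℓ ^ B ≤ C * (3 * ((t : ℝ) * u) * w) * L at hpt
  -- `u ℓ^B ≤ 3 C t w L`
  have h1 : (u : ℝ) * ℓ ^ B ≤ 3 * C * t * w * L := by
    have h' : ((u : ℝ) * ℓ ^ B) * u ≤ (3 * C * t * w * L) * u := by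
      calc ((u : ℝ) * ℓ ^ B) * u = (u : ℝ) ^ 2 * ℓ ^ B := by ring
        _ ≤ C * (3 * ((t : ℝ) * u) * w) * L := hpt
        _ = (3 * C * t * w * L) * u := by ring
    exact le_of_mul_le_mul_right h' huR
  -- `w ℓ^B ≤ 3 C L` (use `w² t ≤ u`, cancel `w t`)
  have h2 : (w : ℝ) * ℓ ^ B ≤ 3 * C * L := by
    have h' : ((w : ℝ) * ℓ ^ B) * (w * t) ≤ (3 * C * L) * (w * t) := by
      calc ((w : ℝ) * ℓ ^ B) * (w * t) = (w * w * t) * ℓ ^ B := by ring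
        _ ≤ u * ℓ ^ B := mul_le_mul_of_nonneg_right hwwtR hℓB.le
        _ ≤ 3 * C * t * w * L := h1
        _ = (3 * C * L) * (w * t) := by ring
    exact le_of_mul_le_mul_right h' (by positivity)
  -- `C > 0`
  have hC : 0 < C := by
    by_contra hC0
    have : 3 * C * L ≤ 0 := by
      have : C * L ≤ 0 := mul_nonpos_of_nonpos_of_nonneg (not_lt.mp hC0) hL0.le
      linarith
    have : 0 < (w : ℝ) * ℓ ^ B := mul_pos hwR hℓB
    linarith
  refine ⟨ℓ, hℓlow, hC, ?_⟩
  -- `ℓ^B ≤ 3 C L / w ≤ 9 C (N+1)`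
  have h3 : (w : ℝ) * ℓ ^ B ≤ (9 * C * ((N : ℝ) + 1)) * w := by
    calc (w : ℝ) * ℓ ^ B ≤ 3 * C * L := h2
      _ ≤ 3 * C * (3 * (((N : ℝ) + 1) * w)) := by nlinarith [hLup, hC]
      _ = (9 * C * ((N : ℝ) + 1)) * w := by ring
  calc ℓ ^ B = ((w : ℝ) * ℓ ^ B) / w := by field_simp
    _ ≤ ((9 * C * ((N : ℝ) + 1)) * w) / w := div_le_div_of_nonneg_right h3 hwR.le
    _ = 9 * C * ((N : ℝ) + 1) := by field_simp

/-- **At `A = 1` even the loss `log c / (log log c)^B` with `B > 1` is false.**  There are no `C, c₀` with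
`c · (log log c)^B ≤ C · Π · log c` for all positive coprime level-4 tower points with `c ≥ c₀` (`B > 1` real;
`log = Real.log`, `^ = Real.rpow`).  Sharpening of `not_towerIneq4One_logLoss` (`(log c)^A`, `A < 1`) to the
exact reach `≍ log c / log log c` of the Pell–Matiyasevich family; `B ≤ 1` is not decided by it. -/
theorem not_towerIneq4One_logLossLogLog (B : ℝ) (hB : 1 < B) :
    ¬ ∃ C c₀ : ℝ, ∀ x y z : Fin 4 → ℕ, (∀ i, 0 < x i ∧ 0 < y i ∧ 0 < z i) →
      (∏ i, x i ^ (i.val + 1)) + (∏ i, y i ^ (i.val + 1)) = ∏ i, z i ^ (i.val + 1) →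
      Nat.Coprime (∏ i, x i ^ (i.val + 1)) (∏ i, y i ^ (i.val + 1)) →
      c₀ ≤ ((∏ i, z i ^ (i.val + 1) : ℕ) : ℝ) →
      ((∏ i, z i ^ (i.val + 1) : ℕ) : ℝ) * Real.log (Real.log (((∏ i, z i ^ (i.val + 1) : ℕ) : ℝ))) ^ B ≤
        C * ((∏ i, x i * y i * z i : ℕ) : ℝ) * Real.log (((∏ i, z i ^ (i.val + 1) : ℕ) : ℝ)) := by
  rintro ⟨C, c₀, h⟩
  have hB0 : 0 < B := by linarith
  have hs1 : 1 / B < 1 := (div_lt_one hB0).mpr hB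
  set K : ℝ := 18 * max C 1 with hK
  have hK0 : 0 ≤ K := by rw [hK]; positivity
  obtain ⟨M, hM1, hM⟩ := key_growth hK0 hs1
  obtain ⟨N, hN⟩ := exists_nat_gt (max M (max 2 c₀))
  have hNM : M < N := lt_of_le_of_lt (le_max_left _ _) hN
  have hN2 : (2 : ℝ) < N := lt_of_le_of_lt ((le_max_left _ _).trans (le_max_right _ _)) hN
  have hNc₀ : c₀ < N := lt_of_le_of_lt ((le_max_right _ _).trans (le_max_right _ _)) hN
  have hN1 : 1 ≤ N := by exact_mod_cast (show (1 : ℝ) ≤ N by linarith)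
  have hN0 : (0 : ℝ) < N := by linarith
  have h2N : c₀ ≤ (2 : ℝ) ^ N := by
    have : (N : ℝ) < (2 : ℝ) ^ N := by exact_mod_cast Nat.lt_two_pow_self
    linarith
  obtain ⟨ℓ, hℓ, hC, hℓB⟩ := logLossLogLog_key h N hN1 h2N
  have hlog3 : 1 < Real.log 3 := by
    rw [Real.lt_log_iff_exp_lt (by norm_num)]
    exact Real.exp_one_lt_three
  -- `N < ℓ`, so `N^B < ℓ^B ≤ 9C(N+1) ≤ 18 C N ≤ K · N`
  have hNℓ : (N : ℝ) < ℓ := lt_of_lt_of_le (by nlinarith) hℓ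
  have hNB : (N : ℝ) ^ B < ℓ ^ B := Real.rpow_lt_rpow hN0.le hNℓ hB0
  have hup : ℓ ^ B ≤ K * N := by
    calc ℓ ^ B ≤ 9 * C * ((N : ℝ) + 1) := hℓB
      _ ≤ 18 * C * N := by nlinarith
      _ ≤ K * N := by
          rw [hK]
          have : C ≤ max C 1 := le_max_left _ _
          nlinarith
  -- `key_growth` at `T = N^B`: `K · (N^B)^{1/B} ≤ N^B`, i.e. `K N ≤ N^B`
  have hT : M ≤ (N : ℝ) ^ B := by
    have : (N : ℝ) ^ (1 : ℝ) ≤ (N : ℝ) ^ B :=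
      Real.rpow_le_rpow_of_exponent_le (by linarith) hB.le
    rw [Real.rpow_one] at this
    linarith
  have hgrow := hM ((N : ℝ) ^ B) hT
  rw [← Real.rpow_mul hN0.le, mul_one_div_cancel hB0.ne', Real.rpow_one] at hgrow
  linarith

end Summit.ABC.ABC.Theorems.TowerFourSubLiouville.Negative
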